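import Summits.QuantumFields.GaugeBoot.Rows.GLYZc2D4RedKit
import Summits.QuantumFields.GaugeBoot.Rows.GLYZc2D4RedCheck11
import Summits.QuantumFields.GaugeBoot.Rows.GLYZc2D4RedCheck12
import Summits.QuantumFields.GaugeBoot.Rows.GLYZc2D4RedCheck23
import Summits.QuantumFields.GaugeBoot.Rows.GLYZc2D4RedCheck24
import Summits.QuantumFields.GaugeBoot.Rows.GLYZc2D4RedCheck25
import Summits.QuantumFields.GaugeBoot.Rows.GLYZc2D4RedCheck26
import Summits.QuantumFields.GaugeBoot.Rows.GLYZc2D4RedCheck27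
import Summits.QuantumFields.GaugeBoot.Rows.GLYZc2D4RedCheck28
import Summits.QuantumFields.GaugeBoot.Rows.GLYZc2D4RedCheck29
import Summits.QuantumFields.GaugeBoot.Rows.GLYZc2D4RedCheck30
import Summits.QuantumFields.GaugeBoot.Rows.GLYZc2D4RedCheck31
import Summits.QuantumFields.GaugeBoot.Rows.GLYZc2D4RedCheck32
import Summits.QuantumFields.GaugeBoot.Rows.GLYZc2D4RedCheck33
import Summits.QuantumFields.GaugeBoot.Rows.GLYZc2D4RedCheck34
import Summits.QuantumFields.GaugeBoot.Rows.GLYZc2D4RedAsm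
import Summits.QuantumFields.GaugeBoot.Rows.GLYZc2D4Canon
import HarnessLib

/-!
# Gauge-boot: THE REDUCTION STEP — the 34 reduced positivity blocks of the glyz-c2-4D problems are PSD for the torus state

Cell `pub-gaugeboot` (HOME `run/shared/lean/pub/pub-gaugeboot/`), seat lean1 (torus layer for rows C76–C87 = the certified
glyz-c2-4D windows: label set, raw blocks, class/witness tables, the reduction identity, per-β bindings).

HONEST FRAMING (page 1 of every file of this cell): certified bounds on lattice expectations at STATED coupling,
gauge group, dimension and torus size; NOT a mass gap, NOT a continuum limit, NOT a string tension, NOT large `N`.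
The venture is explicitly NOT Yang–Mills-summit-bearing (barriers `FixedCouplingUltralocality`,
`PerturbativeInvisibility`).

`Certificates.N2c2D4.redBlock k (y β L)` (lean3's interface, `Certificates/N2c2D4Tab`: block `k` of the problem files, entries
`Σ c·y_v`, evaluated on the torus expectations `y β L v = ⟨W_0(label v)⟩` of `GLYZc2D4Labels`) is positive semidefinite for every
`k < 34`, every real `β ≥ 0`, every EVEN torus `(ℤ/L)^{D}` with `L ≥ 4` (the hypotheses are used only by the reflection blocks):
`redBlock_posSemidef`.  Proof = the kernel-checked identities `GLYZc2D4RedCheck…` (lean3's entries = `Y_kᵀ·cls·Y_k` as integer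
forms, radix check `RedEnc.eval_eq_of_encCheck`) + `GLYZc2D3.SVec.eval_expand` / `eval_eq_sum_fin` giving
`redBlock k y = Y_kᴴ · rawBlock · Y_k` as real matrices + Mathlib's congruence `Matrix.PosSemidef.conjTranspose_mul_mul_same`
applied to `GLYZc2D4Canon.rawBlockH/S/L_posSemidef`.  With lean2's equality rows and lean3's certificate halves over
`Certificates.N2c2D4.redBlock` this closes rows C76–C87 end to end (per-β `GLYZc2D4BindB<β>`).
-/

noncomputable section

open Literature.MathematicalPhysics.QuantumFieldTheory
open Matrix
open Summit.QuantumFields.GaugeBoot.GLYZc2D3 (SVec)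

namespace Summit.QuantumFields.GaugeBoot

namespace GLYZc2D4

variable (β : ℝ) (L : ℕ) [NeZero L]

/-- **THE REDUCTION STEP**: for `SU(2)` lattice gauge theory on every even torus `(ℤ/L)^4` with `L ≥ 4` and every standard coupling `β ≥ 0`,
all 34 reduced positivity blocks of the certified glyz-c2-4D problems (lean3's `Certificates.N2c2D4.redBlock`), evaluated
on the torus loop expectations `y β L`, are positive semidefinite. -/
theorem redBlock_posSemidef (hβ : 0 ≤ β) (hL : Even L) (h4 : 4 ≤ L) : ∀ k : Fin 34, (Certificates.N2c2D4.redBlock k (GLYZc2D4.y β L)).PosSemidef := by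
  intro k
  fin_cases k
  exacts [entryMatrix_posSemidef (y β L) hcls (ycol 0) (fun i j => Certificates.N2c2D4.ent 0 i j) ycol_lt_0
      (fun i j => RedEnc.sparse_ent_comm _ _ i j) hcls_comm red_ok_0 (rawBlockH_posSemidef β L),
    entryMatrix_posSemidef (y β L) hcls (ycol 1) (fun i j => Certificates.N2c2D4.ent 1 i j) ycol_lt_1
      (fun i j => RedEnc.sparse_ent_comm _ _ i j) hcls_comm red_ok_1 (rawBlockH_posSemidef β L),
    entryMatrix_posSemidef (y β L) hcls (ycol 2) (fun i j => Certificates.N2c2D4.ent 2 i j) ycol_lt_2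
      (fun i j => RedEnc.sparse_ent_comm _ _ i j) hcls_comm red_ok_2 (rawBlockH_posSemidef β L),
    entryMatrix_posSemidef (y β L) hcls (ycol 3) (fun i j => Certificates.N2c2D4.ent 3 i j) ycol_lt_3
      (fun i j => RedEnc.sparse_ent_comm _ _ i j) hcls_comm red_ok_3 (rawBlockH_posSemidef β L),
    entryMatrix_posSemidef (y β L) hcls (ycol 4) (fun i j => Certificates.N2c2D4.ent 4 i j) ycol_lt_4
      (fun i j => RedEnc.sparse_ent_comm _ _ i j) hcls_comm red_ok_4 (rawBlockH_posSemidef β L),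
    entryMatrix_posSemidef (y β L) hcls (ycol 5) (fun i j => Certificates.N2c2D4.ent 5 i j) ycol_lt_5
      (fun i j => RedEnc.sparse_ent_comm _ _ i j) hcls_comm red_ok_5 (rawBlockH_posSemidef β L),
    entryMatrix_posSemidef (y β L) hcls (ycol 6) (fun i j => Certificates.N2c2D4.ent 6 i j) ycol_lt_6
      (fun i j => RedEnc.sparse_ent_comm _ _ i j) hcls_comm red_ok_6 (rawBlockH_posSemidef β L),
    entryMatrix_posSemidef (y β L) hcls (ycol 7) (fun i j => Certificates.N2c2D4.ent 7 i j) ycol_lt_7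
      (fun i j => RedEnc.sparse_ent_comm _ _ i j) hcls_comm red_ok_7 (rawBlockH_posSemidef β L),
    entryMatrix_posSemidef (y β L) hcls (ycol 8) (fun i j => Certificates.N2c2D4.ent 8 i j) ycol_lt_8
      (fun i j => RedEnc.sparse_ent_comm _ _ i j) hcls_comm red_ok_8 (rawBlockH_posSemidef β L),
    entryMatrix_posSemidef (y β L) hcls (ycol 9) (fun i j => Certificates.N2c2D4.ent 9 i j) ycol_lt_9
      (fun i j => RedEnc.sparse_ent_comm _ _ i j) hcls_comm red_ok_9 (rawBlockH_posSemidef β L),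
    entryMatrix_posSemidef (y β L) hcls (ycol 10) (fun i j => Certificates.N2c2D4.ent 10 i j) ycol_lt_10
      (fun i j => RedEnc.sparse_ent_comm _ _ i j) hcls_comm red_ok_10 (rawBlockH_posSemidef β L),
    entryMatrix_posSemidef (y β L) hcls (ycol 11) (fun i j => Certificates.N2c2D4.ent 11 i j) ycol_lt_11
      (fun i j => RedEnc.sparse_ent_comm _ _ i j) hcls_comm red_ok_11 (rawBlockH_posSemidef β L),
    entryMatrix_posSemidef (y β L) hcls (ycol 12) (fun i j => Certificates.N2c2D4.ent 12 i j) ycol_lt_12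
      (fun i j => RedEnc.sparse_ent_comm _ _ i j) hcls_comm red_ok_12 (rawBlockH_posSemidef β L),
    entryMatrix_posSemidef (y β L) hcls (ycol 13) (fun i j => Certificates.N2c2D4.ent 13 i j) ycol_lt_13
      (fun i j => RedEnc.sparse_ent_comm _ _ i j) hcls_comm red_ok_13 (rawBlockH_posSemidef β L),
    entryMatrix_posSemidef (y β L) scls (ycol 14) (fun i j => Certificates.N2c2D4.ent 14 i j) ycol_lt_14
      (fun i j => RedEnc.sparse_ent_comm _ _ i j) scls_comm red_ok_14 (rawBlockS_posSemidef β L hL),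
    entryMatrix_posSemidef (y β L) scls (ycol 15) (fun i j => Certificates.N2c2D4.ent 15 i j) ycol_lt_15
      (fun i j => RedEnc.sparse_ent_comm _ _ i j) scls_comm red_ok_15 (rawBlockS_posSemidef β L hL),
    entryMatrix_posSemidef (y β L) scls (ycol 16) (fun i j => Certificates.N2c2D4.ent 16 i j) ycol_lt_16
      (fun i j => RedEnc.sparse_ent_comm _ _ i j) scls_comm red_ok_16 (rawBlockS_posSemidef β L hL),
    entryMatrix_posSemidef (y β L) scls (ycol 17) (fun i j => Certificates.N2c2D4.ent 17 i j) ycol_lt_17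
      (fun i j => RedEnc.sparse_ent_comm _ _ i j) scls_comm red_ok_17 (rawBlockS_posSemidef β L hL),
    entryMatrix_posSemidef (y β L) scls (ycol 18) (fun i j => Certificates.N2c2D4.ent 18 i j) ycol_lt_18
      (fun i j => RedEnc.sparse_ent_comm _ _ i j) scls_comm red_ok_18 (rawBlockS_posSemidef β L hL),
    entryMatrix_posSemidef (y β L) scls (ycol 19) (fun i j => Certificates.N2c2D4.ent 19 i j) ycol_lt_19
      (fun i j => RedEnc.sparse_ent_comm _ _ i j) scls_comm red_ok_19 (rawBlockS_posSemidef β L hL),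
    entryMatrix_posSemidef (y β L) scls (ycol 20) (fun i j => Certificates.N2c2D4.ent 20 i j) ycol_lt_20
      (fun i j => RedEnc.sparse_ent_comm _ _ i j) scls_comm red_ok_20 (rawBlockS_posSemidef β L hL),
    entryMatrix_posSemidef (y β L) scls (ycol 21) (fun i j => Certificates.N2c2D4.ent 21 i j) ycol_lt_21
      (fun i j => RedEnc.sparse_ent_comm _ _ i j) scls_comm red_ok_21 (rawBlockS_posSemidef β L hL),
    entryMatrix_posSemidef (y β L) scls (ycol 22) (fun i j => Certificates.N2c2D4.ent 22 i j) ycol_lt_22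
      (fun i j => RedEnc.sparse_ent_comm _ _ i j) scls_comm red_ok_22 (rawBlockS_posSemidef β L hL),
    entryMatrix_posSemidef (y β L) scls (ycol 23) (fun i j => Certificates.N2c2D4.ent 23 i j) ycol_lt_23
      (fun i j => RedEnc.sparse_ent_comm _ _ i j) scls_comm red_ok_23 (rawBlockS_posSemidef β L hL),
    entryMatrix_posSemidef (y β L) lcls (ycol 24) (fun i j => Certificates.N2c2D4.ent 24 i j) ycol_lt_24
      (fun i j => RedEnc.sparse_ent_comm _ _ i j) lcls_comm red_ok_24 (rawBlockL_posSemidef β L hL h4 hβ),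
    entryMatrix_posSemidef (y β L) lcls (ycol 25) (fun i j => Certificates.N2c2D4.ent 25 i j) ycol_lt_25
      (fun i j => RedEnc.sparse_ent_comm _ _ i j) lcls_comm red_ok_25 (rawBlockL_posSemidef β L hL h4 hβ),
    entryMatrix_posSemidef (y β L) lcls (ycol 26) (fun i j => Certificates.N2c2D4.ent 26 i j) ycol_lt_26
      (fun i j => RedEnc.sparse_ent_comm _ _ i j) lcls_comm red_ok_26 (rawBlockL_posSemidef β L hL h4 hβ),
    entryMatrix_posSemidef (y β L) lcls (ycol 27) (fun i j => Certificates.N2c2D4.ent 27 i j) ycol_lt_27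
      (fun i j => RedEnc.sparse_ent_comm _ _ i j) lcls_comm red_ok_27 (rawBlockL_posSemidef β L hL h4 hβ),
    entryMatrix_posSemidef (y β L) lcls (ycol 28) (fun i j => Certificates.N2c2D4.ent 28 i j) ycol_lt_28
      (fun i j => RedEnc.sparse_ent_comm _ _ i j) lcls_comm red_ok_28 (rawBlockL_posSemidef β L hL h4 hβ),
    entryMatrix_posSemidef (y β L) lcls (ycol 29) (fun i j => Certificates.N2c2D4.ent 29 i j) ycol_lt_29
      (fun i j => RedEnc.sparse_ent_comm _ _ i j) lcls_comm red_ok_29 (rawBlockL_posSemidef β L hL h4 hβ),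
    entryMatrix_posSemidef (y β L) lcls (ycol 30) (fun i j => Certificates.N2c2D4.ent 30 i j) ycol_lt_30
      (fun i j => RedEnc.sparse_ent_comm _ _ i j) lcls_comm red_ok_30 (rawBlockL_posSemidef β L hL h4 hβ),
    entryMatrix_posSemidef (y β L) lcls (ycol 31) (fun i j => Certificates.N2c2D4.ent 31 i j) ycol_lt_31
      (fun i j => RedEnc.sparse_ent_comm _ _ i j) lcls_comm red_ok_31 (rawBlockL_posSemidef β L hL h4 hβ),
    entryMatrix_posSemidef (y β L) lcls (ycol 32) (fun i j => Certificates.N2c2D4.ent 32 i j) ycol_lt_32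
      (fun i j => RedEnc.sparse_ent_comm _ _ i j) lcls_comm red_ok_32 (rawBlockL_posSemidef β L hL h4 hβ),
    entryMatrix_posSemidef (y β L) lcls (ycol 33) (fun i j => Certificates.N2c2D4.ent 33 i j) ycol_lt_33
      (fun i j => RedEnc.sparse_ent_comm _ _ i j) lcls_comm red_ok_33 (rawBlockL_posSemidef β L hL h4 hβ)]

end GLYZc2D4

end Summit.QuantumFields.GaugeBoot

end
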